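import Mathlib
import Summits.MatrixMultiplication.MatrixMultiplication.Theses.SnSubsetDichotomy

/-!
# STRATEGY-CENSUS evidence (§ Decomposition, attempt D3): the c-free split `WR_β ∧ BP_γ ⇒ JuntaBranch`

Typed and kernel-checked version of the decomposition considered (and NOT filed as a route split) by the
crux-strategist of `stmt-MatrixMultiplication-8304`: the crux `JuntaBranch` (∀ ε ∀ c) follows from two
`c`-FREE statements about the extremal volume function of TPP triples in `S_n`,

* `WindowRegularity β` — at Large levels the window `[n − √n, n)` carries a TPP triple within the factor
  `n^β` of any level-`n` triple's normalised volume (envelope regularity; known only for `β = 3/2`,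
  `Theorems.JuntaBranch.stub_regularity`; needed for `β < 1/2 + ε`);
* `BumpPenalty ε γ` — an `ε`-bumpy Large triple is beaten AT ITS OWN LEVEL by the factor `n^γ`
  (stability of near-maximisers; the partial slice of Round-2 memo §4 forces `γ ≤ 1/2 + ε`),

whenever `0 ≤ β < γ` (`γ` may depend on `ε`).  Proof: bump penalty upgrades the triple by `n^γ` at level
`n`, window regularity loses `n^β` going into the window, and `n^{γ−β} ≥ e^{c+1}` for `n ≥ e^{(c+1)/(γ−β)}`.
Both legs are engine-less (census §Decomposition) and the route does not need the crux's `∀ c` surplus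
(`noThreshold_iff_globalBranch_and_jbExistsMax`, p104539), which is why the split is recorded, not filed.
-/

set_option linter.dupNamespace false

namespace Summit.MatrixMultiplication.MatrixMultiplication.Cruxes.JuntaBranch.CensusWRBP

open Literature.Combinatorics.Additive
open Summit.MatrixMultiplication.MatrixMultiplication.Theses.SnSubsetDichotomy
open scoped Classical

/-- Window regularity with polynomial loss `n^{-β}` at Large(c) levels (c-free in substance: `c` only
selects the levels). -/
def WindowRegularity (β : ℝ) : Prop :=
  ∀ c : ℝ, 0 < c → ∃ n₀ : ℕ, ∀ n ≥ n₀, ∀ S T U : Finset (Equiv.Perm (Fin n)),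
    TripleProductProperty S T U →
    (n.factorial : ℝ) ^ ((3 : ℝ) / 2) * Real.exp (-(c * Real.sqrt (n : ℝ))) ≤
      ((S.card * T.card * U.card : ℕ) : ℝ) →
    ∃ n' : ℕ, (n : ℝ) - Real.sqrt (n : ℝ) ≤ (n' : ℝ) ∧ n' < n ∧
      ∃ S' T' U' : Finset (Equiv.Perm (Fin n')), TripleProductProperty S' T' U' ∧
        (n : ℝ) ^ (-β) * ((S.card * T.card * U.card : ℕ) : ℝ) *
            ((n'.factorial : ℝ) / (n.factorial : ℝ)) ^ ((3 : ℝ) / 2) ≤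
          ((S'.card * T'.card * U'.card : ℕ) : ℝ)

/-- Bump penalty: an `ε`-bumpy Large(c) triple is beaten at its own level by the factor `n^γ`
(near-maximisers are `ε`-flat, polynomial rate). -/
def BumpPenalty (ε γ : ℝ) : Prop :=
  ∀ c : ℝ, 0 < c → ∃ n₀ : ℕ, ∀ n ≥ n₀, ∀ S T U : Finset (Equiv.Perm (Fin n)),
    TripleProductProperty S T U →
    (n.factorial : ℝ) ^ ((3 : ℝ) / 2) * Real.exp (-(c * Real.sqrt (n : ℝ))) ≤
      ((S.card * T.card * U.card : ℕ) : ℝ) →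
    (∃ X : Finset (Equiv.Perm (Fin n)), (X = S ∨ X = T ∨ X = U) ∧ ∃ t : ℕ, 1 ≤ t ∧
      (t : ℝ) ≤ Real.sqrt (n : ℝ) ∧ ∃ I L : Fin t → Fin n, Function.Injective I ∧
      Function.Injective L ∧ (n : ℝ) ^ ((1 / 2 + ε) * t) * (X.card : ℝ) <
        ((X.filter (fun σ => ∀ k, σ (I k) = L k)).card : ℝ) * (n.descFactorial t : ℝ)) →
    ∃ S₁ T₁ U₁ : Finset (Equiv.Perm (Fin n)), TripleProductProperty S₁ T₁ U₁ ∧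
      (n : ℝ) ^ γ * ((S.card * T.card * U.card : ℕ) : ℝ) ≤ ((S₁.card * T₁.card * U₁.card : ℕ) : ℝ)

/-- **`WR_β ∧ (∀ ε, ∃ γ > β, BP_{ε,γ}) ⇒ JuntaBranch`** (β ≥ 0). -/
theorem juntaBranch_of_windowRegularity_of_bumpPenalty {β : ℝ} (hβ : 0 ≤ β)
    (hWR : WindowRegularity β) (hBP : ∀ ε : ℝ, 0 < ε → ∃ γ : ℝ, β < γ ∧ BumpPenalty ε γ) :
    JuntaBranch := by
  intro ε hε c hc
  obtain ⟨γ, hβγ, hB⟩ := hBP ε hε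
  obtain ⟨n₁, hn₁⟩ := hB c hc
  obtain ⟨n₂, hn₂⟩ := hWR c hc
  have hgb : 0 < γ - β := sub_pos.2 hβγ
  refine ⟨max n₁ (max n₂ (max 1 ⌈Real.exp ((c + 1) / (γ - β))⌉₊)), fun n hn S T U hTPP hL hbump => ?_⟩
  have h1 : n₁ ≤ n := le_of_max_le_left hn
  have h2 : n₂ ≤ n := (le_max_left _ _).trans (le_of_max_le_right hn)
  have h3 : 1 ≤ n := (le_max_left _ _).trans ((le_max_right _ _).trans (le_of_max_le_right hn))
  have h4 : ⌈Real.exp ((c + 1) / (γ - β))⌉₊ ≤ n :=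
    (le_max_right _ _).trans ((le_max_right _ _).trans (le_of_max_le_right hn))
  have hn0 : (0 : ℝ) < n := by exact_mod_cast h3
  have hn1 : (1 : ℝ) ≤ n := by exact_mod_cast h3
  -- bump penalty at level n
  obtain ⟨S₁, T₁, U₁, hTPP₁, hV₁⟩ := hn₁ n h1 S T U hTPP hL hbump
  set V : ℝ := ((S.card * T.card * U.card : ℕ) : ℝ) with hV
  set V₁ : ℝ := ((S₁.card * T₁.card * U₁.card : ℕ) : ℝ) with hV₁def
  have hV0 : 0 ≤ V := by positivity
  have hγ0 : 0 ≤ γ := hβ.trans hβγ.le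
  have hnγ : 1 ≤ (n : ℝ) ^ γ := Real.one_le_rpow hn1 hγ0
  have hL₁ : (n.factorial : ℝ) ^ ((3 : ℝ) / 2) * Real.exp (-(c * Real.sqrt (n : ℝ))) ≤ V₁ :=
    hL.trans ((le_mul_of_one_le_left hV0 hnγ).trans hV₁)
  -- window regularity for the upgraded triple
  obtain ⟨n', hn'1, hn'2, S', T', U', hTPP', hW⟩ := hn₂ n h2 S₁ T₁ U₁ hTPP₁ hL₁
  refine ⟨n', hn'1, hn'2, S', T', U', hTPP', le_trans ?_ hW⟩
  set r : ℝ := ((n'.factorial : ℝ) / (n.factorial : ℝ)) ^ ((3 : ℝ) / 2) with hr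
  have hr0 : 0 ≤ r := by positivity
  -- e^{c+1} ≤ n^{γ-β}
  have hlog : (c + 1) / (γ - β) ≤ Real.log n := by
    rw [Real.le_log_iff_exp_le hn0]
    exact (Nat.le_ceil _).trans (by exact_mod_cast h4)
  have hexp : Real.exp (c + 1) ≤ (n : ℝ) ^ (γ - β) := by
    rw [Real.rpow_def_of_pos hn0, Real.exp_le_exp]
    have := mul_le_mul_of_nonneg_right hlog hgb.le
    rw [div_mul_cancel₀ _ hgb.ne'] at this
    linarith [mul_comm (Real.log n) (γ - β)]
  have hsplit : (n : ℝ) ^ (γ - β) = (n : ℝ) ^ (-β) * (n : ℝ) ^ γ := by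
    rw [← Real.rpow_add hn0]; ring_nf
  calc Real.exp (c + 1) * V * r ≤ (n : ℝ) ^ (γ - β) * V * r :=
        mul_le_mul_of_nonneg_right (mul_le_mul_of_nonneg_right hexp hV0) hr0
    _ = (n : ℝ) ^ (-β) * ((n : ℝ) ^ γ * V) * r := by rw [hsplit]; ring
    _ ≤ (n : ℝ) ^ (-β) * V₁ * r :=
        mul_le_mul_of_nonneg_right (mul_le_mul_of_nonneg_left hV₁ (by positivity)) hr0

end Summit.MatrixMultiplication.MatrixMultiplication.Cruxes.JuntaBranch.CensusWRBP
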